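import Summits.AtomisticToContinuum.BoseEinsteinCondensation.Theorems.BECConjugateDominationDefs
import Literature.MathematicalPhysics.QuantumManyBody.InsertionStateIdentities
import Literature.MathematicalPhysics.QuantumManyBody.PeriodicFeynmanKacEnergyLower
import Literature.MathematicalPhysics.QuantumManyBody.PeriodicBosonLoopMeasure
import Literature.MathematicalPhysics.QuantumManyBody.PeriodicBoseGasEq317
import Literature.MathematicalPhysics.QuantumManyBody.PeriodicBoseGasImpurityTranslation
import HarnessLib

/-!
# Route `BECConjugateDomination`, glue `IMUChainGlue` (stmt-AtomisticToContinuum-11790) —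
# helper: the translation-averaged coherence `g` and step (i) of the glue

For a periodic trial state `Ψ` of `N = n+1` bosons on the torus of side `L` and its coherence
`g(r) = coherence n L Ψ r = ∫_cell dx ∫_{cell^n} dY |Ψ(x+r,Y)| |Ψ(x,Y)|` (the crux's `let g`):
`g(r) = ∫_{cell^N} |Ψ(X + r e₀)| |Ψ(X)| dX`, `g` is continuous, strictly positive when `Ψ` has no
zeros, and `Lℤ³`-periodic; and **step (i)**: for `Ψ = |Ψ|`,
`condensateOccupation N L Ψ = N · L⁻³ ∫_cell g` (unfold the occupation of the constant mode,
Tonelli, and the substitution `y = x + r` on the torus).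
-/

noncomputable section

open MeasureTheory Set Filter
open scoped ENNReal NNReal Topology

namespace Summit.AtomisticToContinuum.BoseEinsteinCondensation.Theorems.IMUChainGlue

open Literature.MathematicalPhysics.QuantumManyBody.BoseGas
open Summit.AtomisticToContinuum.BoseEinsteinCondensation.Cruxes.InfraredMinimumUncertainty.FisherGaussianDensityMode
  (coherence)

variable {n : ℕ} {L : ℝ}

/-! ### Shifting particle `0` -/

/-- `e₀ ⊗ r = (r, 0, …, 0)` in `(ℝ³)^{n+1}`. -/
theorem single_zero_eq_vecCons (r : Space) :
    (Pi.single (0 : Fin (n + 1)) r : Config (n + 1)) = Matrix.vecCons r 0 := by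
  funext i
  refine Fin.cases ?_ (fun j => ?_) i
  · simp
  · simp [Fin.succ_ne_zero]

/-- `(x, Y) + e₀ ⊗ r = (x + r, Y)`. -/
theorem vecCons_add_single_zero (x r : Space) (Y : Config n) :
    (Matrix.vecCons x Y : Config (n + 1)) + Pi.single 0 r = Matrix.vecCons (x + r) Y := by
  rw [single_zero_eq_vecCons, Matrix.cons_add_cons, add_zero]

/-- A periodic `N`-body function is invariant under lattice translations of particle `0`. -/
theorem apply_add_single_zero_latticeVec {β : Type*} (Ψ : PeriodicTrialState (n + 1) L)
    {f : ℂ → β} (X : Config (n + 1)) (m : Fin 3 → ℤ) :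
    f (Ψ.ψ (X + Pi.single 0 (latticeVec L m))) = f (Ψ.ψ X) := by
  have h := periodic_latticeVec (φ := fun x : Space => f (Ψ.ψ (X + Pi.single 0 x)))
    (fun x k => by
      show f (Ψ.ψ (X + Pi.single 0 (x + EuclideanSpace.single k L))) = f (Ψ.ψ (X + Pi.single 0 x))
      rw [Pi.single_add, ← add_assoc, Ψ.periodic]) 0 m
  simpa using h

/-! ### The coherence as a single cell integral; continuity, positivity, periodicity -/

/-- **The coherence as one integral over the `N`-particle cell**:
`g(r) = ∫_{cell^N} |Ψ(X + r e₀)| |Ψ(X)| dX`. -/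
theorem coherence_eq_setIntegral (Ψ : PeriodicTrialState (n + 1) L) (r : Space) :
    coherence n L Ψ r = ∫ X in cellN (n + 1) L, ‖Ψ.ψ (X + Pi.single 0 r)‖ * ‖Ψ.ψ X‖ := by
  rw [coherence, setIntegral_cellN_succ_left_of_continuous]
  · simp only [vecCons_add_single_zero]
  · exact ((Ψ.contDiff.continuous.comp (continuous_add_const _)).norm).mul Ψ.contDiff.continuous.norm

/-- A periodic trial state is bounded. -/
theorem exists_norm_le (hL : 0 < L) (Ψ : PeriodicTrialState (n + 1) L) :
    ∃ M : ℝ, 0 ≤ M ∧ ∀ X, ‖Ψ.ψ X‖ ≤ M := by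
  obtain ⟨M, hM0, hM⟩ := exists_bound_of_continuous_periodic hL Ψ.contDiff.continuous.norm
    (fun X i k => by rw [Ψ.periodic])
  exact ⟨M, hM0, fun X => le_of_abs_le (hM X)⟩

/-- A zero-free periodic trial state is bounded below by a positive constant. -/
theorem exists_pos_le_norm (hL : 0 < L) (Ψ : PeriodicTrialState (n + 1) L) (hpos : ∀ X, Ψ.ψ X ≠ 0) :
    ∃ m : ℝ, 0 < m ∧ ∀ X, m ≤ ‖Ψ.ψ X‖ := by
  have hc : Continuous fun X => ‖Ψ.ψ X‖⁻¹ :=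
    Ψ.contDiff.continuous.norm.inv₀ fun X => (norm_pos_iff.2 (hpos X)).ne'
  obtain ⟨M, _, hM⟩ := exists_bound_of_continuous_periodic hL hc (fun X i k => by rw [Ψ.periodic])
  have hMpos : 0 < M := by
    have h := hM 0
    have : 0 < ‖Ψ.ψ 0‖⁻¹ := inv_pos.2 (norm_pos_iff.2 (hpos 0))
    rw [abs_of_pos this] at h
    linarith
  refine ⟨M⁻¹, inv_pos.2 hMpos, fun X => ?_⟩
  have h := hM X
  have hn : 0 < ‖Ψ.ψ X‖ := norm_pos_iff.2 (hpos X)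
  rw [abs_of_pos (inv_pos.2 hn)] at h
  rw [inv_le_comm₀ hMpos hn]
  exact h

/-- **The coherence is continuous.** -/
theorem continuous_coherence (Ψ : PeriodicTrialState (n + 1) L) : Continuous (coherence n L Ψ) := by
  have hL := Ψ.side_pos
  obtain ⟨M, hM0, hM⟩ := exists_norm_le hL Ψ
  have hfun : coherence n L Ψ = fun r => ∫ X in cellN (n + 1) L, ‖Ψ.ψ (X + Pi.single 0 r)‖ * ‖Ψ.ψ X‖ :=
    funext (coherence_eq_setIntegral Ψ)
  rw [hfun]
  refine continuous_of_dominated (bound := fun _ => M * M) (fun r => ?_) (fun r => ?_) ?_ ?_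
  · exact (((Ψ.contDiff.continuous.comp (continuous_add_const _)).norm).mul
      Ψ.contDiff.continuous.norm).aestronglyMeasurable
  · refine Eventually.of_forall fun X => ?_
    rw [Real.norm_of_nonneg (mul_nonneg (norm_nonneg _) (norm_nonneg _))]
    exact mul_le_mul (hM _) (hM _) (norm_nonneg _) hM0
  · have : volume (cellN (n + 1) L) < ⊤ := by
      rw [volume_cellN]; exact ENNReal.pow_lt_top (ENNReal.pow_lt_top ENNReal.ofReal_lt_top)
    exact integrableOn_const this.ne
  · refine Eventually.of_forall fun X => ?_
    exact ((Ψ.contDiff.continuous.comp (continuous_const.add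
      (continuous_single (0 : Fin (n + 1))))).norm).mul continuous_const

/-- **The coherence of a zero-free state is strictly positive.** -/
theorem coherence_pos (Ψ : PeriodicTrialState (n + 1) L) (hpos : ∀ X, Ψ.ψ X ≠ 0) (r : Space) :
    0 < coherence n L Ψ r := by
  have hL := Ψ.side_pos
  obtain ⟨m, hm, hmle⟩ := exists_pos_le_norm hL Ψ hpos
  have hΨc := Ψ.contDiff.continuous
  have hFc : Continuous fun X : Config (n + 1) => ‖Ψ.ψ (X + Pi.single 0 r)‖ * ‖Ψ.ψ X‖ :=
    (hΨc.comp (continuous_id.add continuous_const)).norm.mul hΨc.norm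
  rw [coherence_eq_setIntegral]
  have hvol : volume (cellN (n + 1) L) = ENNReal.ofReal ((L ^ 3) ^ (n + 1)) := by
    rw [volume_cellN, ← ENNReal.ofReal_pow hL.le, ← ENNReal.ofReal_pow (by positivity)]
  calc (0 : ℝ) < m * m * (L ^ 3) ^ (n + 1) := by positivity
    _ = ∫ _ in cellN (n + 1) L, m * m := by
        rw [setIntegral_const, Measure.real, hvol, ENNReal.toReal_ofReal (by positivity), smul_eq_mul,
          mul_comm]
    _ ≤ ∫ X in cellN (n + 1) L, ‖Ψ.ψ (X + Pi.single 0 r)‖ * ‖Ψ.ψ X‖ := by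
        refine setIntegral_mono_on ?_ ?_ (measurableSet_cellN _ L) ?_
        · exact integrableOn_const (by rw [hvol]; exact ENNReal.ofReal_ne_top)
        · exact integrableOn_cellN hFc L
        · intro X _
          exact mul_le_mul (hmle _) (hmle _) hm.le (norm_nonneg _)

/-- **The coherence is `Lℤ³`-periodic.** -/
theorem coherence_add_latticeVec (Ψ : PeriodicTrialState (n + 1) L) (r : Space) (m : Fin 3 → ℤ) :
    coherence n L Ψ (r + latticeVec L m) = coherence n L Ψ r := by
  rw [coherence_eq_setIntegral, coherence_eq_setIntegral]
  refine integral_congr_ae (Eventually.of_forall fun X => ?_)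
  simp only
  rw [Pi.single_add, ← add_assoc, apply_add_single_zero_latticeVec Ψ (f := fun z => ‖z‖)]

/-! ### Step (i): the constant-mode occupation is `N L⁻³ ∫_cell g` -/

/-- The coherence is non-negative. -/
theorem coherence_nonneg (Ψ : PeriodicTrialState (n + 1) L) (r : Space) : 0 ≤ coherence n L Ψ r :=
  setIntegral_nonneg (measurableSet_cell L) fun _ _ =>
    setIntegral_nonneg (measurableSet_cellN n L) fun _ _ => mul_nonneg (norm_nonneg _) (norm_nonneg _)

/-- **Step (i) of the glue.** For a periodic trial state with `Ψ = |Ψ|` pointwise,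
`condensateOccupation N L Ψ = ofReal (N · L⁻³ ∫_cell g)`. -/
theorem condensateOccupation_eq_ofReal_integral_coherence (Ψ : PeriodicTrialState (n + 1) L)
    (hreal : ∀ X, Ψ.ψ X = (‖Ψ.ψ X‖ : ℂ)) :
    condensateOccupation (n + 1) L Ψ.ψ =
      ENNReal.ofReal (((n : ℝ) + 1) * ((L ^ 3)⁻¹ * ∫ r in cell L, coherence n L Ψ r)) := by
  have hL := Ψ.side_pos
  obtain ⟨M, hM0, hM⟩ := exists_norm_le hL Ψ
  -- the modulus `Φ₀ = |Ψ|` as an opaque function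
  obtain ⟨Φ₀, hΦ₀⟩ : ∃ Φ₀ : Config (n + 1) → ℝ, Φ₀ = fun X => ‖Ψ.ψ X‖ := ⟨_, rfl⟩
  have hΦc : Continuous Φ₀ := by rw [hΦ₀]; exact Ψ.contDiff.continuous.norm
  have h0 : ∀ X, 0 ≤ Φ₀ X := fun X => by rw [hΦ₀]; exact norm_nonneg _
  have hMΦ : ∀ X, Φ₀ X ≤ M := fun X => by rw [hΦ₀]; exact hM X
  have hperΦ : ∀ (X : Config (n + 1)) (k : Fin 3), Φ₀ (X + Pi.single (0 : Fin (n + 1)) (EuclideanSpace.single k L)) = Φ₀ X :=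
    fun X k => by rw [hΦ₀]; exact congrArg (fun z : ℂ => ‖z‖) (Ψ.periodic X 0 k)
  have hψ : Ψ.ψ = fun X => (Φ₀ X : ℂ) := by rw [hΦ₀]; exact funext hreal
  have hcoh : ∀ r, coherence n L Ψ r =
      ∫ x in cell L, ∫ U in cellN n L, Φ₀ (Matrix.vecCons (x + r) U) * Φ₀ (Matrix.vecCons x U) := by
    intro r; rw [hΦ₀]; rfl
  rw [hψ, condensateOccupation_ofReal_eq hL hΦc.measurable h0 hMΦ]
  -- the slice integrand and its joint measurability
  obtain ⟨F, hF⟩ : ∃ F : Space → Config n → ℝ≥0∞,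
      F = fun x U => ENNReal.ofReal (Φ₀ (Matrix.vecCons x U)) := ⟨_, rfl⟩
  have hvc : Continuous fun p : Space × Config n => (Matrix.vecCons p.1 p.2 : Config (n + 1)) :=
    continuous_fst.matrixVecCons continuous_snd
  have hFm : Measurable fun p : Space × Config n => F p.1 p.2 := by
    rw [hF]; exact ENNReal.measurable_ofReal.comp (hΦc.measurable.comp hvc.measurable)
  obtain ⟨K, hK⟩ : ∃ K : Space → Space → ℝ≥0∞, K = fun x y => ∫⁻ U in cellN n L, F x U * F y U := ⟨_, rfl⟩
  have hKm : Measurable fun q : Space × Space => K q.1 q.2 := by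
    have h3 : Measurable fun q : (Space × Space) × Config n => F q.1.1 q.2 * F q.1.2 q.2 :=
      (hFm.comp ((measurable_fst.comp measurable_fst).prodMk measurable_snd)).mul
        (hFm.comp ((measurable_snd.comp measurable_fst).prodMk measurable_snd))
    rw [hK]; exact h3.lintegral_prod_right'
  -- periodicity of `K x ·` and the torus substitution `y = r + x`
  have hKper : ∀ (x y : Space) (k : Fin 3), K x (y + EuclideanSpace.single k L) = K x y := by
    intro x y k
    rw [hK, hF]
    refine lintegral_congr fun U => ?_
    simp only
    rw [← vecCons_add_single_zero, hperΦ]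
  have hsub : ∀ x, ∫⁻ y in cell L, K x y = ∫⁻ r in cell L, K x (r + x) := by
    intro x
    have h := lintegral_cellN_comp_add (N := 1) hL (G := fun X : Config 1 => K x (X 0))
      (fun X i k => by
        simp only [Pi.add_apply]
        rw [Subsingleton.elim i 0, Pi.single_eq_same, hKper]) (fun _ => x)
    calc ∫⁻ y in cell L, K x y = ∫⁻ X in cellN 1 L, K x (X 0) := (lintegral_cellN_one L fun y => K x y).symm
      _ = ∫⁻ X in cellN 1 L, K x (X 0 + x) := h.symm
      _ = ∫⁻ r in cell L, K x (r + x) := lintegral_cellN_one L fun y => K x (y + x)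
  -- the `r`-slices are the coherence
  have hvoln : volume (cellN n L) = ENNReal.ofReal ((L ^ 3) ^ n) := by
    rw [volume_cellN, ← ENNReal.ofReal_pow hL.le, ← ENNReal.ofReal_pow (by positivity)]
  have hslice : ∀ r, ∫⁻ x in cell L, K x (r + x) = ENNReal.ofReal (coherence n L Ψ r) := by
    intro r
    have hcont2 : Continuous fun p : Space × Config n =>
        Φ₀ (Matrix.vecCons (p.1 + r) p.2) * Φ₀ (Matrix.vecCons p.1 p.2) :=
      (hΦc.comp ((continuous_fst.add continuous_const).matrixVecCons continuous_snd)).mul (hΦc.comp hvc)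
    have hIx : ∀ x, IntegrableOn (fun U => Φ₀ (Matrix.vecCons (x + r) U) * Φ₀ (Matrix.vecCons x U))
        (cellN n L) volume := by
      intro x
      exact integrableOn_cellN (hcont2.comp (continuous_const.prodMk continuous_id)) L
    have hinner : ∀ x, K x (r + x) =
        ENNReal.ofReal (∫ U in cellN n L, Φ₀ (Matrix.vecCons (x + r) U) * Φ₀ (Matrix.vecCons x U)) := by
      intro x
      rw [ofReal_integral_eq_lintegral_ofReal (hIx x) (ae_of_all _ fun U => mul_nonneg (h0 _) (h0 _)),
        hK, hF]
      refine lintegral_congr fun U => ?_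
      simp only
      rw [ENNReal.ofReal_mul (h0 _), add_comm r x, mul_comm]
    simp only [hinner]
    rw [hcoh r, ← ofReal_integral_eq_lintegral_ofReal]
    · -- integrability of the inner Bochner integral in `x`: bounded and measurable
      refine Measure.integrableOn_of_bounded (M := M * M * (L ^ 3) ^ n) ?_ ?_ ?_
      · rw [volume_cell]; exact ENNReal.pow_ne_top ENNReal.ofReal_ne_top
      · exact (hcont2.stronglyMeasurable.integral_prod_right'
          (ν := volume.restrict (cellN n L))).aestronglyMeasurable
      · refine ae_of_all _ fun x => ?_
        rw [Real.norm_of_nonneg (setIntegral_nonneg (measurableSet_cellN n L) fun U _ =>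
          mul_nonneg (h0 _) (h0 _))]
        calc ∫ U in cellN n L, Φ₀ (Matrix.vecCons (x + r) U) * Φ₀ (Matrix.vecCons x U)
            ≤ ∫ _ in cellN n L, M * M := by
              refine setIntegral_mono_on (hIx x) ?_ (measurableSet_cellN n L) ?_
              · exact integrableOn_const (by rw [hvoln]; exact ENNReal.ofReal_ne_top)
              · intro U _
                exact mul_le_mul (hMΦ _) (hMΦ _) (h0 _) hM0
          _ = M * M * (L ^ 3) ^ n := by
              rw [setIntegral_const, Measure.real, hvoln, ENNReal.toReal_ofReal (by positivity),
                smul_eq_mul, mul_comm]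
    · exact ae_of_all _ fun x => setIntegral_nonneg (measurableSet_cellN n L) fun U _ =>
        mul_nonneg (h0 _) (h0 _)
  -- assemble: pull out `N`, substitute, swap, identify
  have hNtop : (n + 1 : ℝ≥0∞) ≠ ⊤ := by simp
  have hstep : ∫⁻ x in cell L, ∫⁻ y in cell L, (n + 1 : ℕ) * K x y =
      (n + 1 : ℝ≥0∞) * ∫⁻ r in cell L, ENNReal.ofReal (coherence n L Ψ r) := by
    have h1 : ∀ x, ∫⁻ y in cell L, (n + 1 : ℕ) * K x y = (n + 1 : ℝ≥0∞) * ∫⁻ r in cell L, K x (r + x) := by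
      intro x
      rw [lintegral_const_mul' _ _ (by simp), hsub x]
      push_cast
      rfl
    simp only [h1]
    rw [lintegral_const_mul' _ _ hNtop]
    congr 1
    have hsw : Measurable fun q : Space × Space => K q.1 (q.2 + q.1) :=
      hKm.comp (measurable_fst.prodMk (measurable_snd.add measurable_fst))
    rw [lintegral_lintegral_swap hsw.aemeasurable]
    exact lintegral_congr fun r => hslice r
  have hKxy : ∀ x y, (∫⁻ U in cellN n L, ENNReal.ofReal (Φ₀ (Matrix.vecCons x U)) *
      ENNReal.ofReal (Φ₀ (Matrix.vecCons y U))) = K x y := by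
    intro x y; rw [hK, hF]
  simp only [hKxy]
  rw [hstep, ← ofReal_integral_eq_lintegral_ofReal (integrableOn_cell (continuous_coherence Ψ))
    (ae_of_all _ fun r => coherence_nonneg Ψ r), ← ENNReal.ofReal_pow hL.le,
    ← ENNReal.ofReal_inv_of_pos (by positivity)]
  have hN : (n + 1 : ℝ≥0∞) = ENNReal.ofReal ((n : ℝ) + 1) := by
    rw [show ((n : ℝ) + 1) = ((n + 1 : ℕ) : ℝ) by push_cast; rfl, ENNReal.ofReal_natCast,
      Nat.cast_add_one]
  rw [hN, ← ENNReal.ofReal_mul (by positivity), ← ENNReal.ofReal_mul (by positivity)]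
  congr 1
  ring

end Summit.AtomisticToContinuum.BoseEinsteinCondensation.Theorems.IMUChainGlue

end
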